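import Literature.NumberTheory.EllipticCurves.NewformsLevelRaising
import Literature.NumberTheory.EllipticCurves.CuspFormLFunctionFrickeProofs
import Literature.NumberTheory.EllipticCurves.HeckeOperatorsProofs
import HarnessLib

/-!
# Crux `ThetaLayerLambdaCongruenceAtTwo` (stmt-BirchSwinnertonDyer-20688, route ResidualThetaTransportAtTwo), line
# `birth` v9, stub (C3k), plan ITEM B5: THE `S`-DEPLETED EIGENFORM `g = ∑_{(n,S)=1} a_n(f) qⁿ ∈ S₂(Γ₀(M·∏_{ℓ∈S} ℓ²))`
# as a CUSP FORM — existence and its Hecke relations `T_p g = a_p(f) g` (`p ∉ S`), `U_ℓ g = 0` (`ℓ ∈ S`) (width seat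
# bsd-wall-rtt-p3-w3 g3; `--supports stmt-BirchSwinnertonDyer-20688 --as helper`; closes nothing)

HONEST FRAMING. THEOREMS about the tree's cusp forms on `Γ₀`, built from the tree's sieve `K_p = 1 − ι_p U_p`
(`sieveOp`, `qExpansion_coeff_sieveOp`: `a_n(K_p f) = 𝟙_{p∤n} a_n(f)`) iterated over a finite set of primes, and the
`q`-expansion of `T_p` (`qExpansion_coeff_heckeT_holds`). No definition, no named fact; nothing about any elliptic
curve is asserted; BSD is not proved by any of this.

WHY (ITEM B5). The spine `…StarEigenform` evaluates the period homology `Λ = H₁(X₀(N''), ℤ)` at a REAL Hecke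
eigenform `g` on which the eigen-ideal `𝔪 = (2, T_q − a_q(W), U_ℓ)` acts by even integers; at an `f`-depleted
level `N'' = N·∏_{ℓ∈S} ℓ²` the `S`-depletion of the newform `f` of `W` is that `g` (and the bridge `…StarBridge` /
`…StarOddIsogeny` with the optimal-quotient fact `eichlerShimura_optimalQuotient_periodLattice` does the rest).

WHAT.
* `exists_cuspForm_coeff_eq_depleted` (§1): for `f ∈ S₂(Γ₀(M))` and a finite set `S` of primes there is
  `g ∈ S₂(Γ₀(L))`, `L = M·∏_{ℓ∈S} ℓ²`, with `a_n(g) = 0` if some `ℓ ∈ S` divides `n` and `a_n(g) = a_n(f)` otherwise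
  (induction on `S` with the tree's `sieveOp`).
* `depleted_heckeT_eq_smul` / `depleted_heckeT_eq_zero` / `depleted_coeff_one` / `depleted_coeff_int` (§2): if
  moreover `T_p f = a_p(f) f` for all primes `p` (newform-type `f`) then `T_p g = a_p(f) g` for primes `p ∉ S`,
  `U_ℓ g = 0` for `ℓ ∈ S`, `a₁(g) = a₁(f)`, and integrality / reality of the coefficients is inherited;
  `depleted_heckeT_eq_coeff_smul`: `T_p g = a_p(g) g` for EVERY prime `p` (the hypothesis shape of
  `eichlerShimura_optimalQuotient_periodLattice`).
* `exists_depleted_eigenform` (§3): the package.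

References: [AtkinLehner1970] §2–3 (the operators `B_d`, `U_p`, `f ↦ f − f∣U_p∣B_p`); [DiamondShurman2005] §5.7–5.8.
-/

noncomputable section

-- justification: the `Summit.BirchSwinnertonDyer.BirchSwinnertonDyer.…` path repeats a component (route-file convention)
set_option linter.dupNamespace false

open scoped MatrixGroups ModularForm

open CongruenceSubgroup UpperHalfPlane
open Literature.NumberTheory.EllipticCurves Literature.NumberTheory.EllipticCurves.ModularForms

namespace Summit.BirchSwinnertonDyer.BirchSwinnertonDyer.Theorems.ThetaLayerLambdaCongruenceAtTwo

/-! ## §1. Existence of the depleted form by iterating the sieve -/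

section Existence

/-- A product of squares of primes is nonzero. [folklore] -/
theorem prod_sq_ne_zero_of_prime (S : Finset ℕ) (hS : ∀ ℓ ∈ S, ℓ.Prime) : ∏ ℓ ∈ S, ℓ ^ 2 ≠ 0 :=
  Finset.prod_ne_zero_iff.mpr fun ℓ hℓ ↦ pow_ne_zero 2 (hS ℓ hℓ).ne_zero

/-- **The `S`-depleted form exists.** For `f ∈ S₂(Γ₀(M))` and a finite set `S` of primes, at level
`L = M · ∏_{ℓ∈S} ℓ²` there is a cusp form `g` with `a_n(g) = 0` when some `ℓ ∈ S` divides `n` and `a_n(g) = a_n(f)`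
otherwise — the iterate of the tree's sieves `K_ℓ = 1 − ι_ℓ U_ℓ` (Atkin–Lehner `f − f∣U_ℓ∣B_ℓ`).
[cite: AtkinLehner1970, §3] -/
theorem exists_cuspForm_coeff_eq_depleted {M : ℕ} [NeZero M] (f : CuspForm (Gamma0 M) 2) (S : Finset ℕ)
    (hS : ∀ ℓ ∈ S, ℓ.Prime) (L : ℕ) [NeZero L] (hL : L = M * ∏ ℓ ∈ S, ℓ ^ 2) :
    ∃ g : CuspForm (Gamma0 L) 2, ∀ n : ℕ, cuspCoeff g n = if ∃ ℓ ∈ S, ℓ ∣ n then 0 else cuspCoeff f n := by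
  classical
  induction S using Finset.induction_on generalizing L with
  | empty =>
    subst hL
    refine ⟨toLevel0 (dvd_mul_right M _) 2 f, fun n ↦ ?_⟩
    simp only [Finset.notMem_empty, false_and, exists_false, if_false]
    rfl
  | insert ℓ S hℓS ih =>
    have hSp : ∀ ℓ' ∈ S, ℓ'.Prime := fun ℓ' h ↦ hS ℓ' (Finset.mem_insert_of_mem h)
    have hℓ : ℓ.Prime := hS ℓ (Finset.mem_insert_self ℓ S)
    set L₀ : ℕ := M * ∏ ℓ' ∈ S, ℓ' ^ 2 with hL₀
    haveI : NeZero L₀ := ⟨mul_ne_zero (NeZero.ne M) (prod_sq_ne_zero_of_prime S hSp)⟩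
    haveI : NeZero ℓ := ⟨hℓ.ne_zero⟩
    obtain ⟨g₀, hg₀⟩ := ih hSp L₀ rfl
    have hL' : L = L₀ * ℓ * ℓ := by
      rw [hL, Finset.prod_insert hℓS, hL₀]; ring
    subst hL'
    refine ⟨sieveOp L₀ 2 ℓ g₀, fun n ↦ ?_⟩
    change (qExpansion 1 ⇑(sieveOp L₀ 2 ℓ g₀)).coeff n = _
    rw [qExpansion_coeff_sieveOp hℓ g₀ n]
    change (if ℓ ∣ n then 0 else cuspCoeff g₀ n) = _
    rw [hg₀ n]
    by_cases hℓn : ℓ ∣ n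
    · rw [if_pos hℓn, if_pos ⟨ℓ, Finset.mem_insert_self ℓ S, hℓn⟩]
    · rw [if_neg hℓn]
      by_cases hex : ∃ ℓ' ∈ S, ℓ' ∣ n
      · obtain ⟨ℓ', hℓ', hd⟩ := hex
        rw [if_pos ⟨ℓ', hℓ', hd⟩, if_pos ⟨ℓ', Finset.mem_insert_of_mem hℓ', hd⟩]
      · rw [if_neg hex, if_neg]
        rintro ⟨ℓ', hℓ', hd⟩
        rcases Finset.mem_insert.mp hℓ' with rfl | h
        · exact hℓn hd
        · exact hex ⟨ℓ', h, hd⟩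

end Existence

/-! ## §2. Hecke relations of the depleted form from its coefficients -/

section Hecke

variable {M L : ℕ} [NeZero M] [NeZero L]

/-- `a_n(T_p h) = a_{pn}(h) + 𝟙_{p∤L}·p·𝟙_{p∣n}·a_{n/p}(h)` in weight `2` (the tree's `qExpansion_coeff_heckeT_holds`).
[cite: DiamondShurman2005, Prop. 5.2.2(a) and Prop. 5.3.1] -/
theorem cuspCoeff_heckeT_two (h : CuspForm (Gamma0 L) 2) {p : ℕ} (hp : p.Prime) (n : ℕ) :
    cuspCoeff ((haveI : NeZero p := ⟨hp.ne_zero⟩; heckeT (Gamma0 L) 2 p) h) n =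
      cuspCoeff h (p * n) + (if p ∣ L then 0 else (p : ℂ) * (if p ∣ n then cuspCoeff h (n / p) else 0)) := by
  haveI : NeZero p := ⟨hp.ne_zero⟩
  have e := qExpansion_coeff_heckeT_holds L 2 h p hp n
  rw [show ((2 : ℤ) - 1) = 1 by norm_num, zpow_one] at e
  exact e

/-- The Hecke recursion of an eigenvector: `T_p f = a • f` gives `a·a_m(f) = a_{pm}(f) + 𝟙_{p∤M} p 𝟙_{p∣m} a_{m/p}(f)`.
[cite: DiamondShurman2005, Prop. 5.8.5] -/
theorem coeff_recursion_of_heckeT_eq_smul (f : CuspForm (Gamma0 M) 2) {p : ℕ} (hp : p.Prime) {a : ℂ}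
    (hT : (haveI : NeZero p := ⟨hp.ne_zero⟩; heckeT (Gamma0 M) 2 p f) = a • f) (m : ℕ) :
    a * cuspCoeff f m = cuspCoeff f (p * m) + (if p ∣ M then 0 else (p : ℂ) * (if p ∣ m then cuspCoeff f (m / p) else 0)) := by
  rw [← cuspCoeff_heckeT_two f hp m, hT, cuspCoeff_smul]

variable {S : Finset ℕ} {f : CuspForm (Gamma0 M) 2} {g : CuspForm (Gamma0 L) 2}

omit [NeZero M] [NeZero L] in
/-- `a₁(g) = a₁(f)` for the depleted form. [folklore] -/
theorem depleted_coeff_one (hS : ∀ ℓ ∈ S, ℓ.Prime)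
    (hg : ∀ n : ℕ, cuspCoeff g n = if ∃ ℓ ∈ S, ℓ ∣ n then 0 else cuspCoeff f n) :
    cuspCoeff g 1 = cuspCoeff f 1 := by
  rw [hg 1, if_neg]
  rintro ⟨ℓ, hℓ, hd⟩
  exact (hS ℓ hℓ).ne_one (Nat.dvd_one.mp hd)

omit [NeZero M] [NeZero L] in
/-- Integer coefficients are inherited by the depleted form. [folklore] -/
theorem depleted_coeff_int (hint : ∀ n : ℕ, ∃ z : ℤ, cuspCoeff f n = z)
    (hg : ∀ n : ℕ, cuspCoeff g n = if ∃ ℓ ∈ S, ℓ ∣ n then 0 else cuspCoeff f n) (n : ℕ) :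
    ∃ z : ℤ, cuspCoeff g n = z := by
  rw [hg n]
  split_ifs
  · exact ⟨0, by simp⟩
  · exact hint n

omit [NeZero M] [NeZero L] in
/-- Real coefficients are inherited by the depleted form. [folklore] -/
theorem depleted_coeff_im (hreal : ∀ n : ℕ, (cuspCoeff f n).im = 0)
    (hg : ∀ n : ℕ, cuspCoeff g n = if ∃ ℓ ∈ S, ℓ ∣ n then 0 else cuspCoeff f n) (n : ℕ) :
    (cuspCoeff g n).im = 0 := by
  rw [hg n]
  split_ifs
  · simp
  · exact hreal n

omit [NeZero M] in
/-- **`U_ℓ g = 0` for `ℓ ∈ S`** (`ℓ ∣ L`): `a_n(U_ℓ g) = a_{ℓn}(g) = 0`. [cite: AtkinLehner1970, §3] -/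
theorem depleted_heckeT_eq_zero (hg : ∀ n : ℕ, cuspCoeff g n = if ∃ ℓ ∈ S, ℓ ∣ n then 0 else cuspCoeff f n)
    {ℓ : ℕ} (hℓ : ℓ.Prime) (hℓS : ℓ ∈ S) (hℓL : ℓ ∣ L) :
    (haveI : NeZero ℓ := ⟨hℓ.ne_zero⟩; heckeT (Gamma0 L) 2 ℓ g) = 0 := by
  haveI : NeZero ℓ := ⟨hℓ.ne_zero⟩
  refine eq_of_forall_cuspCoeff_eq_gamma0 fun n ↦ ?_
  rw [cuspCoeff_heckeT_two g hℓ n, if_pos hℓL, add_zero, hg (ℓ * n), if_pos ⟨ℓ, hℓS, dvd_mul_right ℓ n⟩]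
  change (0 : ℂ) = (qExpansion 1 ⇑(0 : CuspForm (Gamma0 L) 2)).coeff n
  rw [CuspForm.coe_zero, UpperHalfPlane.qExpansion_zero]
  simp

/-- **`T_p g = a_p(f) g` for primes `p ∉ S`**, when `T_p f = a_p(f) f` and `p ∣ L ↔ p ∣ M` (the levels have the
same primes outside `S`). [cite: AtkinLehner1970, §3] -/
theorem depleted_heckeT_eq_smul (hS : ∀ ℓ ∈ S, ℓ.Prime)
    (hg : ∀ n : ℕ, cuspCoeff g n = if ∃ ℓ ∈ S, ℓ ∣ n then 0 else cuspCoeff f n)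
    {p : ℕ} (hp : p.Prime) (hpS : p ∉ S) (hpLM : p ∣ L ↔ p ∣ M)
    (hT : (haveI : NeZero p := ⟨hp.ne_zero⟩; heckeT (Gamma0 M) 2 p f) = cuspCoeff f p • f) :
    (haveI : NeZero p := ⟨hp.ne_zero⟩; heckeT (Gamma0 L) 2 p g) = cuspCoeff f p • g := by
  haveI : NeZero p := ⟨hp.ne_zero⟩
  classical
  -- divisibility bookkeeping: `p` is coprime to every `ℓ ∈ S`
  have hcop : ∀ ℓ ∈ S, Nat.Coprime ℓ p := fun ℓ hℓ ↦
    (Nat.coprime_primes (hS ℓ hℓ) hp).mpr fun h ↦ hpS (h ▸ hℓ)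
  have hiff : ∀ n, (∃ ℓ ∈ S, ℓ ∣ p * n) ↔ (∃ ℓ ∈ S, ℓ ∣ n) := fun n ↦ by
    constructor
    · rintro ⟨ℓ, hℓ, hd⟩
      exact ⟨ℓ, hℓ, (hcop ℓ hℓ).dvd_of_dvd_mul_left hd⟩
    · rintro ⟨ℓ, hℓ, hd⟩
      exact ⟨ℓ, hℓ, hd.mul_left p⟩
  have hiff' : ∀ n, p ∣ n → ((∃ ℓ ∈ S, ℓ ∣ n / p) ↔ (∃ ℓ ∈ S, ℓ ∣ n)) := fun n hpn ↦ by
    obtain ⟨m, rfl⟩ := hpn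
    rw [Nat.mul_div_cancel_left m hp.pos]
    exact (hiff m).symm
  refine eq_of_forall_cuspCoeff_eq_gamma0 fun n ↦ ?_
  rw [cuspCoeff_heckeT_two g hp n, cuspCoeff_smul, hg (p * n), hg n]
  have hrec := coeff_recursion_of_heckeT_eq_smul f hp hT n
  by_cases hex : ∃ ℓ ∈ S, ℓ ∣ n
  · -- all terms vanish
    rw [if_pos ((hiff n).mpr hex), if_pos hex, mul_zero]
    by_cases hpn : p ∣ n
    · rw [if_pos hpn, hg (n / p), if_pos ((hiff' n hpn).mpr hex)]
      simp
    · rw [if_neg hpn]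
      simp
  · rw [if_neg ((hiff n).not.mpr hex), if_neg hex, hrec]
    congr 1
    by_cases hpM : p ∣ M
    · rw [if_pos hpM, if_pos (hpLM.mpr hpM)]
    · rw [if_neg hpM, if_neg (fun h ↦ hpM (hpLM.mp h))]
      by_cases hpn : p ∣ n
      · rw [if_pos hpn, if_pos hpn, hg (n / p), if_neg ((hiff' n hpn).not.mpr hex)]
      · rw [if_neg hpn, if_neg hpn]

/-- **`T_p g = a_p(g) g` for EVERY prime `p`** (the eigenform hypothesis of
`eichlerShimura_optimalQuotient_periodLattice`): for `p ∉ S` it is `a_p(f) g` with `a_p(g) = a_p(f)`; for `ℓ ∈ S`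
both sides vanish (`U_ℓ g = 0`, `a_ℓ(g) = 0`). Requires every `ℓ ∈ S` to divide `L` and `p ∣ L ↔ p ∣ M` off `S`.
[cite: AtkinLehner1970, §3] -/
theorem depleted_heckeT_eq_coeff_smul (hS : ∀ ℓ ∈ S, ℓ.Prime) (hSL : ∀ ℓ ∈ S, ℓ ∣ L)
    (hLM : ∀ p : ℕ, p.Prime → p ∉ S → (p ∣ L ↔ p ∣ M))
    (hg : ∀ n : ℕ, cuspCoeff g n = if ∃ ℓ ∈ S, ℓ ∣ n then 0 else cuspCoeff f n)
    (hT : ∀ (p : ℕ) (hp : p.Prime), (haveI : NeZero p := ⟨hp.ne_zero⟩; heckeT (Gamma0 M) 2 p f) = cuspCoeff f p • f)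
    (p : ℕ) (hp : p.Prime) :
    (haveI : NeZero p := ⟨hp.ne_zero⟩; heckeT (Gamma0 L) 2 p g) = cuspCoeff g p • g := by
  by_cases hpS : p ∈ S
  · rw [depleted_heckeT_eq_zero hg hp hpS (hSL p hpS), hg p, if_pos ⟨p, hpS, dvd_rfl⟩, zero_smul]
  · rw [depleted_heckeT_eq_smul hS hg hp hpS (hLM p hp hpS) (hT p hp), hg p, if_neg]
    rintro ⟨ℓ, hℓ, hd⟩
    exact hpS (((Nat.prime_dvd_prime_iff_eq (hS ℓ hℓ) hp).mp hd) ▸ hℓ)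

end Hecke

/-! ## §3. The package -/

section Package

/-- Primes of `L = M·∏_{ℓ∈S} ℓ²` off `S` are the primes of `M`. [folklore] -/
theorem dvd_level_iff {M : ℕ} {S : Finset ℕ} (hS : ∀ ℓ ∈ S, ℓ.Prime) {L : ℕ} (hL : L = M * ∏ ℓ ∈ S, ℓ ^ 2)
    {p : ℕ} (hp : p.Prime) (hpS : p ∉ S) : p ∣ L ↔ p ∣ M := by
  rw [hL]
  refine ⟨fun h ↦ ?_, fun h ↦ h.mul_right _⟩
  rcases (Nat.Prime.dvd_mul hp).mp h with h | h
  · exact h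
  · exfalso
    obtain ⟨ℓ, hℓ, hd⟩ := (Prime.dvd_finsetProd_iff hp.prime _).mp h
    have := (Nat.prime_dvd_prime_iff_eq hp (hS ℓ hℓ)).mp (hp.dvd_of_dvd_pow hd)
    exact hpS (this ▸ hℓ)

/-- Every `ℓ ∈ S` divides `L = M·∏_{ℓ∈S} ℓ²`. [folklore] -/
theorem dvd_level_of_mem {M : ℕ} {S : Finset ℕ} {L : ℕ} (hL : L = M * ∏ ℓ ∈ S, ℓ ^ 2) {ℓ : ℕ} (hℓ : ℓ ∈ S) :
    ℓ ∣ L := by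
  rw [hL]
  exact ((dvd_pow_self ℓ two_ne_zero).trans (Finset.dvd_prod_of_mem (fun ℓ' ↦ ℓ' ^ 2) hℓ)).mul_left M

/-- **The depleted eigenform.** Let `f ∈ S₂(Γ₀(M))` be an eigenvector of every `T_p` with eigenvalue `a_p(f)`
(`p` prime; `U_p` for `p ∣ M`), with integer Fourier coefficients and `a₁(f) = 1` (e.g. the newform of an elliptic
curve over `ℚ`), and let `S` be a finite set of primes. Then at level `L = M·∏_{ℓ∈S} ℓ²` there is a cusp form `g`
with: integer (hence real) coefficients, `a₁(g) = 1`, `a_n(g) = 𝟙_{(n,S)=1} a_n(f)`, `T_p g = a_p(f) g` for primes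
`p ∉ S`, `U_ℓ g = 0` for `ℓ ∈ S`, and `T_p g = a_p(g) g` for every prime `p`. [cite: AtkinLehner1970, §3] -/
theorem exists_depleted_eigenform {M : ℕ} [NeZero M] (f : CuspForm (Gamma0 M) 2)
    (hint : ∀ n : ℕ, ∃ z : ℤ, cuspCoeff f n = z) (h1 : cuspCoeff f 1 = 1)
    (hT : ∀ (p : ℕ) (hp : p.Prime), (haveI : NeZero p := ⟨hp.ne_zero⟩; heckeT (Gamma0 M) 2 p f) = cuspCoeff f p • f)
    (S : Finset ℕ) (hS : ∀ ℓ ∈ S, ℓ.Prime) (L : ℕ) [NeZero L] (hL : L = M * ∏ ℓ ∈ S, ℓ ^ 2) :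
    ∃ g : CuspForm (Gamma0 L) 2,
      (∀ n : ℕ, cuspCoeff g n = if ∃ ℓ ∈ S, ℓ ∣ n then 0 else cuspCoeff f n) ∧
      (∀ n : ℕ, ∃ z : ℤ, cuspCoeff g n = z) ∧ (∀ n : ℕ, (cuspCoeff g n).im = 0) ∧ cuspCoeff g 1 = 1 ∧
      (∀ (p : ℕ) (hp : p.Prime), p ∉ S → (haveI : NeZero p := ⟨hp.ne_zero⟩; heckeT (Gamma0 L) 2 p g) = cuspCoeff f p • g) ∧
      (∀ (ℓ : ℕ) (hℓ : ℓ.Prime), ℓ ∈ S → (haveI : NeZero ℓ := ⟨hℓ.ne_zero⟩; heckeT (Gamma0 L) 2 ℓ g) = 0) ∧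
      (∀ (p : ℕ) (hp : p.Prime), (haveI : NeZero p := ⟨hp.ne_zero⟩; heckeT (Gamma0 L) 2 p g) = cuspCoeff g p • g) := by
  obtain ⟨g, hg⟩ := exists_cuspForm_coeff_eq_depleted f S hS L hL
  have hreal : ∀ n : ℕ, (cuspCoeff f n).im = 0 := fun n ↦ by
    obtain ⟨z, hz⟩ := hint n
    rw [hz, Complex.intCast_im]
  refine ⟨g, hg, depleted_coeff_int hint hg, depleted_coeff_im hreal hg, (depleted_coeff_one hS hg).trans h1,
    fun p hp hpS ↦ depleted_heckeT_eq_smul hS hg hp hpS (dvd_level_iff hS hL hp hpS) (hT p hp),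
    fun ℓ hℓ hℓS ↦ depleted_heckeT_eq_zero hg hℓ hℓS (dvd_level_of_mem hL hℓS),
    depleted_heckeT_eq_coeff_smul hS (fun ℓ h ↦ dvd_level_of_mem hL h) (fun p hp hpS ↦ dvd_level_iff hS hL hp hpS)
      hg hT⟩

end Package

end Summit.BirchSwinnertonDyer.BirchSwinnertonDyer.Theorems.ThetaLayerLambdaCongruenceAtTwo

end
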